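import Literature.RepresentationTheory.BorelWallach2000.UpqHarmonicHodgeDecomposition
import Literature.Algebra.Lie.ChevalleyEilenbergLowDegree
import HarnessLib

/-!
# FLOOR-0 P3b «ENGINE local packets», line `F0_EngineLocalPackets` — STUB T3j CLOSED: the values of a closed
# `(𝔤, K)`-1-cochain of `U(α, β)` of `J`-type `δ = ±1` are `𝔭^{−δ}`-null (the junction lemma)

Cell hodgecm-mathlib (D-0151), FLOOR 0, crux item H413 = stmt-HodgeConjecture-24833; sub-line `Cruxes/H413/Lines/F0_EngineLocalPackets.lean`
(F0P3b-plan (g0), edition 1, sha16 808dda7dd1cd10bb), registered stub `stub_T3j_cocycleValuesPNull : StubT3jCocycleValuesPNull` (§2 there).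
PROOF lane (theorems only); author A-p09 (g18).  Per the cell's stub-closer protocol (director s347) the Lines module is NOT imported: the
theorem's TYPE is the body of `…Cruxes.H413.F0EngineLocalPackets.StubT3jCocycleValuesPNull` BINDER FOR BINDER with the Lines-local
predicate `IsPNull ρ𝔤 δ (f Y)` δ-UNFOLDED to its definiens
`∀ s, ⁅upqPBasis s, f Y⁆ + ((δ : ℂ) * Complex.I) • ⁅⁅upqZ0 α β, upqPBasis s⁆, f Y⁆ = 0`, so the by-name fold
`theorem stub_T3j_cocycleValuesPNull : StubT3jCocycleValuesPNull := F0P3bStubT3jCocycleValuesPNull.stubT3j_holds` elaborates by `δ`.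

THE COMPUTATION ([BorelWallach2000, II §4.2 (3)]; [Rogawski1990, §15.2, proof of 15.2.1 (b)]).  Let `f ∈ C¹_δ(𝔲(α,β), K; V)` be closed,
`δ² = 1`, `μ = δ i`, `J = ad z₀`.  (a) `f` vanishes on `𝔨` (relative cochain) and `d f = 0` reads `f(⁅X, Y⁆) = X·f(Y) − Y·f(X)`;
with `X = z₀`: `f(JZ) = z₀·f(Z) = μ f(Z)` (the type condition is on VALUES, ★ `mem_upqType_iff`), hence `f(Z) + μ f(JZ) = (1 + μ²) f(Z) = 0`
for every `Z`.  (b) For `X, Y ∈ 𝔭`-generators `⁅X, Y⁆ ∈ 𝔨` (★ `upq_lie_upqUnit_mem_kInLie`), so `X·f(Y) = Y·f(X)`; with `J x_s` again a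
`𝔭`-generator (★ `lie_upqZ0_upqUnit`): `x_s·f(x_t) + μ (Jx_s)·f(x_t) = x_t·(f(x_s) + μ f(Jx_s)) = 0`.  (c) A general `Y` is
`k + Σ_t c_t x_t` (★ `upq_exists_kInLie_add_sum_upqPBasis`), `f(k) = 0`, and everything is `ℝ`-linear.

HONEST LABEL: HC_CM is proved only modulo the 7 printed citations until rung 0 closes; this file discharges none of them.
-/

-- Mathlib idiom (as in `GKModules`, `GKCohomology`, the `Upq*` files and the Lines file): commutator bracket on `Module.End`
attribute [local instance 100] LieRing.ofAssociativeRing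

set_option autoImplicit false
set_option linter.dupNamespace false

noncomputable section

namespace Summit.HodgeConjecture.HodgeConjecture.Cruxes.H413.F0P3bStubT3jCocycleValuesPNull

open Literature.Algebra.Lie Literature.Algebra.Lie.ChevalleyEilenberg
open Literature.NumberTheory.Automorphic
open Literature.RepresentationTheory.BorelWallach2000
open Literature.RepresentationTheory.KonnoKonno2007 Literature.RepresentationTheory.KonnoKonno2007.RealDualPair
open Literature.RepresentationTheory.KonnoKonno2007.RealDualPair.UForm

/-- **Stub T3j of `Lines/F0_EngineLocalPackets.lean`, proved** (the body of `StubT3jCocycleValuesPNull`, `IsPNull` unfolded): the values of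
a closed `(𝔤, K)`-1-cochain of `U(α, β)` of `J`-type `δ`, `δ² = 1`, are `𝔭^{−δ}`-null —
`ρ𝔤(x_s) f(Y) + δ i · ρ𝔤(⁅z₀, x_s⁆) f(Y) = 0` on the `𝔭`-frame. [cite: BorelWallach2000, II §4.2 (3)] [cite: Rogawski1990, §15.2] -/
theorem stubT3j_holds :
    ∀ (α β : Type) [Fintype α] [DecidableEq α] [Fintype β] [DecidableEq β]
      (V : Type) [AddCommGroup V] [Module ℂ V]
      (ρK : Representation ℂ (uFormGroup α β).maximalCompact V) (ρ𝔤 : (uFormGroup α β).lie →ₗ⁅ℝ⁆ Module.End ℂ V)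
      (hV : ∀ (k : (uFormGroup α β).maximalCompact) (X : (uFormGroup α β).lie), ρK k ∘ₗ ρ𝔤 X ∘ₗ ρK k⁻¹ =
        ρ𝔤 ((uFormGroup α β).Ad (Subgroup.inclusion (uFormGroup α β).maximalCompact_le_carrier k) X))
      (δ : ℤ), δ * δ = 1 →
      ∀ (f : Cochain ℝ (uFormGroup α β).lie (GKCarrier (uFormGroup α β) ρ𝔤) 1),
        f ∈ upqType ρK ρ𝔤 hV 1 δ → d ℝ (uFormGroup α β).lie (GKCarrier (uFormGroup α β) ρ𝔤) 1 f = 0 →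
        ∀ Y : Fin 1 → (uFormGroup α β).lie,
          ∀ s : (α × β) × Fin 2, ⁅upqPBasis s, f Y⁆ + ((δ : ℂ) * Complex.I) • ⁅⁅upqZ0 α β, upqPBasis s⁆, f Y⁆ = 0 := by
  intro α β _ _ _ _ V _ _ ρK ρ𝔤 hV δ hδ f hf hd Y s
  obtain ⟨hfC, hfz⟩ := (mem_upqType_iff ρK ρ𝔤 hV 1 δ f).1 hf
  have hcoc := (d_one_eq_zero_iff (R := ℝ) f).1 hd
  -- (a) relative cochains vanish on `𝔨`
  have hhor : ∀ Z ∈ (uFormGroup α β).kInLie, f ![Z] = 0 := by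
    intro Z hZ
    have h := (((mem_gkComplex_succ_iff (uFormGroup α β) ρK ρ𝔤 hV 0 f).1 hfC).1 Z hZ).2
    have e := congrArg (fun g : Cochain ℝ (uFormGroup α β).lie (GKCarrier (uFormGroup α β) ρ𝔤) 0 => g ![]) h
    simpa only [ins_apply, AlternatingMap.zero_apply] using e
  -- the scalar `μ = δ i`, `μ² = −1`
  have hμ : ((δ : ℂ) * Complex.I) * ((δ : ℂ) * Complex.I) = -1 := by
    have hδC : (δ : ℂ) * (δ : ℂ) = 1 := by exact_mod_cast hδ
    rw [mul_mul_mul_comm, hδC, Complex.I_mul_I, one_mul]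
  -- (a') `f(JZ) = μ f(Z)` and `f(Z) + μ f(JZ) = 0`
  have hJval : ∀ Z : (uFormGroup α β).lie, f ![⁅upqZ0 α β, Z⁆] = ((δ : ℂ) * Complex.I) • f ![Z] := by
    intro Z
    rw [hcoc, hhor _ upqZ0_mem_kInLie, lie_zero, sub_zero, GKCarrier.bracket_def]
    exact hfz ![Z]
  have hkill : ∀ Z : (uFormGroup α β).lie, f ![Z] + ((δ : ℂ) * Complex.I) • f ![⁅upqZ0 α β, Z⁆] = 0 := by
    intro Z
    rw [hJval, smul_smul, hμ, neg_one_smul, add_neg_cancel]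
  -- (b) symmetry `X·f(Y) = Y·f(X)` when `⁅X, Y⁆ ∈ 𝔨`
  have hsym : ∀ X Z : (uFormGroup α β).lie, ⁅X, Z⁆ ∈ (uFormGroup α β).kInLie → ⁅X, f ![Z]⁆ = ⁅Z, f ![X]⁆ := by
    intro X Z hXZ
    have h := hcoc X Z
    rw [hhor _ hXZ] at h
    exact (sub_eq_zero.1 h.symm)
  have hJ : ⁅upqZ0 α β, upqPBasis s⁆ = upqUnit s.1 (Complex.I * upqPCoeff s.2) := by
    rw [upqPBasis, lie_upqZ0_upqUnit]
  -- (b') the frame case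
  have hframe : ∀ t : (α × β) × Fin 2,
      ⁅upqPBasis s, f ![upqPBasis t]⁆ + ((δ : ℂ) * Complex.I) • ⁅⁅upqZ0 α β, upqPBasis s⁆, f ![upqPBasis t]⁆ = 0 := by
    intro t
    have h1 : ⁅upqPBasis s, f ![upqPBasis t]⁆ = ⁅upqPBasis t, f ![upqPBasis s]⁆ :=
      hsym _ _ (upq_lie_upqPBasis_mem_kInLie s t)
    have h2 : ⁅⁅upqZ0 α β, upqPBasis s⁆, f ![upqPBasis t]⁆ = ⁅upqPBasis t, f ![⁅upqZ0 α β, upqPBasis s⁆]⁆ :=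
      hsym _ _ (by rw [hJ]; exact upq_lie_upqUnit_mem_kInLie _ _ _ _)
    rw [h1, h2, ← LieSMulComm.lie_smul_comm, ← lie_add, hkill, lie_zero]
  -- (c) a general argument: `Y 0 = k + Σ_t c_t x_t`, `f(k) = 0`, linearity
  have hY : Y = ![Y 0] := by
    funext i
    fin_cases i
    rfl
  obtain ⟨k, hk, c, hY0⟩ := upq_exists_kInLie_add_sum_upqPBasis (Y 0)
  -- the value functional `Z ↦ f(Z)` and the operator `v ↦ x_s·v + μ (Jx_s)·v`, as `ℝ`-linear maps on `V`
  let φ : (uFormGroup α β).lie →ₗ[ℝ] V :=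
    { toFun := fun Z => (f ![Z] : V)
      map_add' := fun x y => by
        change f (Matrix.vecCons (x + y) ![]) = f (Matrix.vecCons x ![]) + f (Matrix.vecCons y ![])
        exact f.map_vecCons_add ![] x y
      map_smul' := fun r x => by
        change f (Matrix.vecCons (r • x) ![]) = r • f (Matrix.vecCons x ![])
        exact f.map_vecCons_smul ![] r x }
  let N : V →ₗ[ℝ] V :=
    (ρ𝔤 (upqPBasis s) + ((δ : ℂ) * Complex.I) • ρ𝔤 ⁅upqZ0 α β, upqPBasis s⁆).restrictScalars ℝ
  have hNφ : ∀ Z : (uFormGroup α β).lie,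
      N (φ Z) = ⁅upqPBasis s, f ![Z]⁆ + ((δ : ℂ) * Complex.I) • ⁅⁅upqZ0 α β, upqPBasis s⁆, f ![Z]⁆ := fun _ => rfl
  have hφk : φ k = 0 := hhor k hk
  have hφt : ∀ t, N (φ (upqPBasis t)) = 0 := fun t => by rw [hNφ]; exact hframe t
  rw [hY, ← hNφ]
  show N (φ (Y 0)) = (0 : V)
  rw [hY0, map_add, map_add, hφk, map_zero, zero_add, map_sum, map_sum]
  refine Finset.sum_eq_zero fun t _ => ?_
  rw [map_smul, map_smul, hφt, smul_zero]

end Summit.HodgeConjecture.HodgeConjecture.Cruxes.H413.F0P3bStubT3jCocycleValuesPNull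

end
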